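import Summits.SmoothPoincare4.SmoothPoincare4.Theses.VerlindeRLinks
import Literature.Barriers.SmoothPoincare4.PropertyTwoRAndrewsCurtisLink
import HarnessLib
import Summits.SmoothPoincare4.SmoothPoincare4.Theorems.VrlSlideGap.Negative.BirthLineVersusSliceRigidity
import HarnessLib.Audit

/-!
# `VrlSliceRigidity` is false modulo `SliceRigidityACObstruction` (negative lemma modulo H)

Crux `Summit.SmoothPoincare4.SmoothPoincare4.Theses.VerlindeRLinks.VrlSliceRigidity`
(stmt-SmoothPoincare4-16179): every R-link all of whose components are smoothly slice in `B⁴`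
strictly handle-slides to a `0`-framed unlink.  Standing disprover's work file
`Cruxes/VrlSliceRigidity/Disproof.lean` §3.

`H = SliceRigidityACObstruction` (the one `@[conjecture] def` of this file — an obligation of
our theory, not a literature fact; refuters cannot file stand-alone obligation nodes, gate ruling
on the dry-run of `Theorems/SliceRigidityACObstruction.lean`): GST's slice R-link leaf for `L_{n,1}` (printed, GST
2010 §7–§8 + Gompf 1991, not yet formalised) ∧ `AKPresentationsACNontrivial` (OPEN — the
unconstructible conjunct: "there is presently no way to distinguish Andrews-Curtis equivalence
classes from each other", GST §7), under the proved instance `Knot.TubularNbhd.SmoothnessFacts`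
carried as a leading `∃` conjunct.

THE LEMMA `VrlSliceRigidity_false_of_SliceRigidityACObstruction : H → ¬ VrlSliceRigidity` is the
sibling crux-attack theorem `VrlSlideGap.Negative.VrlSliceRigidity_false_of_acNontrivial` (apply
the crux to `L_{n,1}`; its slide-triviality makes `gstPresentation n` Andrews–Curtis trivial)
packaged over the single hypothesis `H`, so that the hold / construction bookkeeping attaches to
THIS item.  Reading: the crux's only lever over printed GPRC — component sliceness — is met by the
Andrews–Curtis-suspicious family, so the crux does not evade the barrier
`Literature.Barriers.SmoothPoincare4.StrictPropertyTwoRBarrier`; a proof of the crux is a proof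
that every `AK(n)`, `n ≥ 3`, is unstably Andrews–Curtis trivial (landed contrapositive: the
sibling `VrlSlideGap.Negative.not_akPresentationsACNontrivial_of_sliceRigidity`).  This is NOT a
refutation: `H` is open.

References: [GompfScharlemannThompson2010, §1 p. 2, §7 (arXiv p. 17), §8 (arXiv p. 18), Conj. 3];
[Gompf1991Killing]; [AkbulutKirby1985]; arXiv:2501.18601 (stable AC-triviality of AK(3)).
-/

noncomputable section

-- The namespace is prescribed by the crux protocol (`Summit.<P>.<Sub>.Theorems.<Crux>.Negative`
-- with `P = Sub = SmoothPoincare4`), hence the duplicated component.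
set_option linter.dupNamespace false

namespace Summit.SmoothPoincare4.SmoothPoincare4.Theorems.VrlSliceRigidity.Negative

open scoped Manifold ContDiff
open Literature.Topology.FourManifolds
open Literature.Barriers.SmoothPoincare4 (gstPresentation AKPresentationsACNontrivial)
open Summit.SmoothPoincare4.SmoothPoincare4.Theses.VerlindeRLinks (VrlSliceRigidity)
open Summit.SmoothPoincare4.SmoothPoincare4.Theorems.VrlSlideGap.Negative
  (VrlSliceRigidity_false_of_acNontrivial)

/-- OPEN CONJECTURE — **the Andrews–Curtis obstruction to slice rigidity**: GST's links
`L_{n,1}` exist as typed slice R-links whose strict slide-triviality forces Andrews–Curtis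
triviality of `⟨x, y ∣ yxy = xyx, xⁿ⁺¹ = yⁿ⟩` (printed: Gompf–Scharlemann–Thompson 2010 §7, arXiv
p. 17, and §8, arXiv p. 18, with Gompf 1991), AND some such presentation with `n ≥ 3` is
Andrews–Curtis nontrivial (`AKPresentationsACNontrivial`, open — GST §1 p. 2: "Andrews-Curtis
nontrivial, as is deemed likely by group theorists when `n ≥ 3`").  Its consequence
`¬ VrlSliceRigidity` is `Theorems/VrlSliceRigidity/Negative/FalseOfACObstruction.lean`; by the
sibling `VrlSlideGap/Negative/BirthLineVersusSliceRigidity.lean` it also yields `VrlSlideGap`.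
Not a dischargeable fact (conjunct 2 is the unstable Andrews–Curtis problem on its standard test
family); use only as a hypothesis `(h : SliceRigidityACObstruction)`.
[cite: GompfScharlemannThompson2010, §7 (arXiv p. 17), §8 (arXiv p. 18), §1 p. 2]
[cite: Gompf1991Killing, handle diagram (GST's [Go1])] [cite: AkbulutKirby1985, §1] [status: open] -/
@[conjecture] def SliceRigidityACObstruction : Prop :=
  ∃ (_ : Knot.TubularNbhd.SmoothnessFacts),
    (∀ n : ℕ, ∃ L : FramedLink (Fin 2),
      (∃ (Y : Type) (_ : TopologicalSpace Y) (_ : T2Space Y) (_ : SecondCountableTopology Y)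
          (_ : ChartedSpace (EuclideanSpace ℝ (Fin 3)) Y) (_ : IsManifold (𝓡 3) ∞ Y)
          (_ : CompactSpace Y) (_ : ConnectedSpace Y),
          IsSphereTwoProdCircleSum 2 Y ∧ L.IsSurgery (𝓡 3) Y) ∧
      (∀ i : Fin 2, (L.component i).IsSmoothlySlice) ∧
      ∀ U : FramedLink (Fin 2), U.IsZeroFramedUnlink →
        IsStrictHandleSlideEquivalent ⟨2, L⟩ ⟨2, U⟩ →
          IsAndrewsCurtisEquivalent (gstPresentation n) (BalancedPresentation.trivial 2)) ∧
    AKPresentationsACNontrivial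


/-- **`VrlSliceRigidity` is false modulo `SliceRigidityACObstruction`**: feed GST's `L_{n,1}` (an
R-link with slice components) to the crux; the resulting strict slides to a `0`-framed unlink make
`gstPresentation n` Andrews–Curtis trivial, contradicting Andrews–Curtis nontriviality — the
sibling theorem `VrlSlideGap.Negative.VrlSliceRigidity_false_of_acNontrivial` over the single
hypothesis `H`. [cite: GompfScharlemannThompson2010, §7 and Conjecture 3] -/
theorem VrlSliceRigidity_false_of_SliceRigidityACObstruction :
    SliceRigidityACObstruction → ¬ VrlSliceRigidity := by
  rintro ⟨inst, hGST, hAC⟩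
  exact @VrlSliceRigidity_false_of_acNontrivial inst hGST hAC

end Summit.SmoothPoincare4.SmoothPoincare4.Theorems.VrlSliceRigidity.Negative

end
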